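import Summits.CriticalPhenomena.PercolationContinuityZ3.Theorems.PercNearOneGluingNoHeavyLowerTailStarSetWordDesignations
import Summits.CriticalPhenomena.PercolationContinuityZ3.Theorems.PercNearOneGluingNoHeavyLowerTailStarSetWordCaps
import Summits.CriticalPhenomena.PercolationContinuityZ3.Theorems.PercNearOneGluingNoHeavyLowerTailStarSetOmegaCliques
import HarnessLib

/-!
# `NoHeavyLowerTail` (stmt-CriticalPhenomena-4575) — the pool words of the residual bound are class-words, III: CROSS words (blueprint §G4)

Support file (prover `prim-gen-swap` gen 15; `--supports stmt-CriticalPhenomena-4575`).  No definitions, no named facts, no sorries.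

The CROSS words `(X→e_X, Y→ē_Y, J→s_X)` of the ordered unmatched hub pairs `(X, Y)` of a partner group `J` (file `…StarSetResidualPoolInst`)
are bounded by the part `cr(T)` of the capacity of `T = {X, Y, J}` consisting of the designations that point SOME chord of `T` into a
forest class of `T` (here `X → e_X ∈ J`): the two words of an unordered pair are two distinct such designations (`two_words_le_cap_filter`),
and `{X, Y} ↦ {X, Y, J}` is injective.  The complementary part `wc(T)` is reserved for the chord-rider family (`familyRiderC_bound`).

* `StarSet.sum_offDiag_symm_rel` — `Σ_X Σ_{Y ≠ X, R X Y} g X Y = Σ_X Σ_{X < Y, R X Y} (g X Y + g Y X)` for symmetric `R`;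
* `StarSet.pool_words_cross_le` — the bound.
-/

namespace Summit.CriticalPhenomena.PercolationContinuityZ3.Theorems

open Finset
open scoped BigOperators Classical

namespace StarSet

variable {ι V : Type*} [Fintype ι] [LinearOrder ι] [DecidableEq V]

omit [Fintype ι] [DecidableEq V] in
/-- **Symmetrisation over ordered pairs with a symmetric constraint.** -/
theorem sum_offDiag_symm_rel (H : Finset ι) (R : ι → ι → Prop) [DecidableRel R] (hR : ∀ X ∈ H, ∀ Y ∈ H, R X Y → R Y X)
    (g : ι → ι → ℝ) :
    ∑ X ∈ H, ∑ Y ∈ H.filter (fun Y => Y ≠ X ∧ R X Y), g X Y =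
      ∑ X ∈ H, ∑ Y ∈ H.filter (fun Y => X < Y ∧ R X Y), (g X Y + g Y X) := by
  have hsplit : ∀ X ∈ H, ∑ Y ∈ H.filter (fun Y => Y ≠ X ∧ R X Y), g X Y =
      ∑ Y ∈ H.filter (fun Y => X < Y ∧ R X Y), g X Y + ∑ Y ∈ H.filter (fun Y => Y < X ∧ R X Y), g X Y := by
    intro X _
    rw [← sum_filter_add_sum_filter_not (H.filter (fun Y => Y ≠ X ∧ R X Y)) (fun Y => X < Y), filter_filter, filter_filter]
    congr 1
    · exact sum_congr (filter_congr fun Y _ => ⟨fun h => ⟨h.2, h.1.2⟩, fun h => ⟨⟨ne_of_gt h.1, h.2⟩, h.1⟩⟩) fun _ _ => rfl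
    · refine sum_congr (filter_congr fun Y _ => ?_) fun _ _ => rfl
      constructor
      · rintro ⟨⟨h1, h2⟩, h3⟩; exact ⟨lt_of_le_of_ne (not_lt.1 h3) h1, h2⟩
      · rintro ⟨h1, h2⟩; exact ⟨⟨ne_of_lt h1, h2⟩, not_lt.2 h1.le⟩
  rw [sum_congr rfl hsplit, sum_add_distrib]
  have hswap : ∑ X ∈ H, ∑ Y ∈ H.filter (fun Y => Y < X ∧ R X Y), g X Y =
      ∑ X ∈ H, ∑ Y ∈ H.filter (fun Y => X < Y ∧ R X Y), g Y X := by
    rw [show (∑ X ∈ H, ∑ Y ∈ H.filter (fun Y => Y < X ∧ R X Y), g X Y) =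
        ∑ X ∈ H, ∑ Y ∈ H, (if (Y < X ∧ R X Y) then g X Y else 0) from sum_congr rfl fun X _ => sum_filter _ _, sum_comm]
    refine sum_congr rfl fun Y hY => ?_
    rw [sum_filter]
    refine sum_congr rfl fun X hX => ?_
    by_cases h : Y < X ∧ R Y X
    · rw [if_pos h, if_pos ⟨h.1, hR Y hY X hX h.2⟩]
    · rw [if_neg h, if_neg (fun h' => h ⟨h'.1, hR X hX Y hY h'.2⟩)]
  rw [hswap, ← sum_add_distrib]
  exact sum_congr rfl fun X _ => (sum_add_distrib).symm

/-- **CROSS words are bounded by the `cr`-part of the capacities of their class-sets.**  Units `u ∈ Ug` as in `residual_pool_inst`. -/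
theorem pool_words_cross_le (P P' : ι → V) (hPP' : ∀ X, P X ≠ P' X) (r : V) (F : Finset ι)
    (O : ι → V → ℝ) (hO0 : ∀ X d, 0 ≤ O X d) (dom : ι → V → ι) (I₀ : ι)
    (Ug : Finset (Finset ι × ι)) (Jf : Finset ι × ι → ι) (ef ēf : Finset ι × ι → V)
    (hUg : ∀ u ∈ Ug, u.2 ∈ u.1 ∧ u.2 ∉ F ∧ (P u.2 ≠ r ∧ P' u.2 ≠ r) ∧ Jf u ∈ u.1 ∧ Jf u ∈ F ∧
      (P (Jf u) ≠ r ∧ P' (Jf u) ≠ r) ∧ Jf u ≠ I₀ ∧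
      ((P u.2 = ef u ∧ P' u.2 = ēf u) ∨ (P u.2 = ēf u ∧ P' u.2 = ef u)) ∧ (P (Jf u) = ef u ∨ P' (Jf u) = ef u) ∧
      ¬ (P (Jf u) = ēf u ∨ P' (Jf u) = ēf u) ∧ (P (dom u.2 (ēf u)) = r ∨ P' (dom u.2 (ēf u)) = r) ∧
      ¬ (P' (dom u.2 (ēf u)) = r ∧ Jf u = dom u.2 (ef u)) ∧
      (∀ K ∈ u.1, K ≠ u.2 → K ≠ Jf u → (P K = r ∨ P' K = r)) ∧
      (∀ Y ∈ u.1, P Y = P u.2 ∨ P Y = P' u.2 ∨ P' Y = P u.2 ∨ P' Y = P' u.2)) :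
    ∑ J ∈ Ug.image Jf, ∑ X ∈ (Ug.filter (fun u => Jf u = J)).image Prod.snd,
        ∑ Y ∈ ((Ug.filter (fun u => Jf u = J)).image Prod.snd).filter (fun Y => Y ≠ X ∧ ¬ (X ≠ Y ∧ (if (P X = P J ∨ P X = P' J) then P' X
              else P X) = (if (P Y = P J ∨ P Y = P' J) then P' Y else P Y))),
          (O X (if (P X = P J ∨ P X = P' J) then P X else P' X) * O Y (if (P Y = P J ∨ P Y = P' J) then P' Y else P Y)
                * O J (if P J = (if (P X = P J ∨ P X = P' J) then P X else P' X) then P' J else P J)) ≤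
      ∑ T ∈ ((Ug ×ˢ Ug).filter (fun w => Jf w.1 = Jf w.2 ∧ w.1.2 < w.2.2 ∧
          ¬ (w.1.2 ≠ w.2.2 ∧ (if (P w.1.2 = P (Jf w.1) ∨ P w.1.2 = P' (Jf w.1)) then P' w.1.2
                else P w.1.2) = (if (P w.2.2 = P (Jf w.1) ∨ P w.2.2 = P' (Jf w.1)) then P' w.2.2
                else P w.2.2)))).image (fun w => ({w.1.2, w.2.2, Jf w.1} : Finset ι)),
        (∑ δ ∈ ((univ : Finset (ι → Bool)).filter (fun δ => (∀ K ∉ T, δ K = false) ∧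
            3 ≤ (T.image fun K => if δ K then P K else P' K).card ∧ r ∉ T.image fun K => if δ K then P K else P' K)).filter
            (fun δ => ¬ ∀ K ∈ T, K ∉ F → ∀ I ∈ T, I ∈ F →
              (if δ K then P K else P' K) ≠ P I ∧ (if δ K then P K else P' K) ≠ P' I),
          ∏ K ∈ T, O K (if δ K then P K else P' K)) := by
  set eJ : ι → ι → V := fun J X => (if (P X = P J ∨ P X = P' J) then P X else P' X) with heJ
  set ēJ : ι → ι → V := fun J X => (if (P X = P J ∨ P X = P' J) then P' X else P X) with hēJ
  set sJ : ι → ι → V := fun J X => (if P J = (if (P X = P J ∨ P X = P' J) then P X else P' X) then P' J else P J) with hsJ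
  set w : ι → ι → ι → ℝ := fun J X Y => O X (eJ J X) * O Y (ēJ J Y) * O J (sJ J X) with hw
  set cr : Finset ι → ℝ := fun T => ∑ δ ∈ ((univ : Finset (ι → Bool)).filter (fun δ => (∀ K ∉ T, δ K = false) ∧
      3 ≤ (T.image fun K => if δ K then P K else P' K).card ∧ r ∉ T.image fun K => if δ K then P K else P' K)).filter
      (fun δ => ¬ ∀ K ∈ T, K ∉ F → ∀ I ∈ T, I ∈ F → (if δ K then P K else P' K) ≠ P I ∧ (if δ K then P K else P' K) ≠ P' I),
    ∏ K ∈ T, O K (if δ K then P K else P' K) with hcr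
  have hcr0 : ∀ T, 0 ≤ cr T := fun T => sum_nonneg fun δ _ => prod_nonneg fun K _ => hO0 _ _
  set Js : Finset ι := Ug.image Jf with hJs
  set 𝒳 : ι → Finset ι := fun J => (Ug.filter (fun u => Jf u = J)).image Prod.snd with h𝒳
  have hsel : ∀ u ∈ Ug, eJ (Jf u) u.2 = ef u ∧ ēJ (Jf u) u.2 = ēf u := by
    intro u hu
    obtain ⟨-, -, -, -, -, -, -, hX, hJe, hJē, -⟩ := hUg u hu
    simp only [heJ, hēJ]
    rcases hX with ⟨h1, h2⟩ | ⟨h1, h2⟩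
    · have hc : P u.2 = P (Jf u) ∨ P u.2 = P' (Jf u) := by
        rw [h1]; rcases hJe with h | h; exacts [Or.inl h.symm, Or.inr h.symm]
      rw [if_pos hc, if_pos hc]; exact ⟨h1, h2⟩
    · have hc : ¬ (P u.2 = P (Jf u) ∨ P u.2 = P' (Jf u)) := by
        rw [h1]; rintro (h | h); exacts [hJē (Or.inl h.symm), hJē (Or.inr h.symm)]
      rw [if_neg hc, if_neg hc]; exact ⟨h2, h1⟩
  have hsJ_spec : ∀ u ∈ Ug, (P (Jf u) = sJ (Jf u) u.2 ∨ P' (Jf u) = sJ (Jf u) u.2) ∧ sJ (Jf u) u.2 ≠ ef u := by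
    intro u hu
    have he := (hsel u hu).1
    simp only [hsJ]
    rw [show (if (P u.2 = P (Jf u) ∨ P u.2 = P' (Jf u)) then P u.2 else P' u.2) = eJ (Jf u) u.2 from rfl, he]
    by_cases h : P (Jf u) = ef u
    · rw [if_pos h]; exact ⟨Or.inr rfl, fun h' => hPP' (Jf u) (h.trans h'.symm)⟩
    · rw [if_neg h]; exact ⟨Or.inl rfl, h⟩
  have hwit : ∀ J X, X ∈ 𝒳 J → ∃ u ∈ Ug, Jf u = J ∧ u.2 = X := by
    intro J X hX
    obtain ⟨u, hu, rfl⟩ := mem_image.1 hX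
    obtain ⟨huU, huJ⟩ := mem_filter.1 hu
    exact ⟨u, huU, huJ, rfl⟩
  have hXfacts : ∀ J X, X ∈ 𝒳 J → X ∉ F ∧ (P X ≠ r ∧ P' X ≠ r) ∧ J ∈ F ∧ (P J ≠ r ∧ P' J ≠ r) ∧
      ((P X = eJ J X ∧ P' X = ēJ J X) ∨ (P X = ēJ J X ∧ P' X = eJ J X)) ∧ (P J = eJ J X ∨ P' J = eJ J X) ∧
      ¬ (P J = ēJ J X ∨ P' J = ēJ J X) ∧ (P J = sJ J X ∨ P' J = sJ J X) ∧ sJ J X ≠ eJ J X := by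
    intro J X hX
    obtain ⟨u, hu, rfl, rfl⟩ := hwit J X hX
    obtain ⟨-, hXF, hXr, -, hJF, hJr, -, hXp, hJe, hJē, -⟩ := hUg u hu
    obtain ⟨he, hē⟩ := hsel u hu
    obtain ⟨hs, hse⟩ := hsJ_spec u hu
    rw [← he] at hXp hJe hse; rw [← hē] at hXp hJē
    exact ⟨hXF, hXr, hJF, hJr, hXp, hJe, hJē, hs, hse⟩
  have hport_r : ∀ (K : ι) (x : V), (P K ≠ r ∧ P' K ≠ r) → (P K = x ∨ P' K = x) → x ≠ r := by
    rintro K x hK (h | h)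
    · rw [← h]; exact hK.1
    · rw [← h]; exact hK.2
  -- step 1: symmetrise each group
  have hsym : ∀ J ∈ Js, ∑ X ∈ 𝒳 J, ∑ Y ∈ (𝒳 J).filter (fun Y => Y ≠ X ∧ ¬ (X ≠ Y ∧ ēJ J X = ēJ J Y)), w J X Y =
      ∑ X ∈ 𝒳 J, ∑ Y ∈ (𝒳 J).filter (fun Y => X < Y ∧ ¬ (X ≠ Y ∧ ēJ J X = ēJ J Y)), (w J X Y + w J Y X) :=
    fun J _ => sum_offDiag_symm_rel (𝒳 J) (fun X Y => ¬ (X ≠ Y ∧ ēJ J X = ēJ J Y))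
      (fun X _ Y _ h h' => h ⟨Ne.symm h'.1, h'.2.symm⟩) (w J)
  -- step 2: the two words of an unordered pair
  have hpair : ∀ J ∈ Js, ∀ X ∈ 𝒳 J, ∀ Y ∈ (𝒳 J).filter (fun Y => X < Y ∧ ¬ (X ≠ Y ∧ ēJ J X = ēJ J Y)),
      w J X Y + w J Y X ≤ cr ({X, Y, J} : Finset ι) := by
    intro J hJ X hX Y hY
    obtain ⟨hY, hlt, hnm⟩ := mem_filter.1 hY
    have hXY : X ≠ Y := ne_of_lt hlt
    have hēē : ēJ J X ≠ ēJ J Y := fun h => hnm ⟨hXY, h⟩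
    obtain ⟨hXF, hXr, hJF, hJr, hXp, heX', hJēX, hJsX, hseX⟩ := hXfacts J X hX
    obtain ⟨hYF, hYr, -, -, hYp, heY', hJēY, hJsY, hseY⟩ := hXfacts J Y hY
    have heX : P X = eJ J X ∨ P' X = eJ J X := by rcases hXp with ⟨h, _⟩ | ⟨_, h⟩; exacts [Or.inl h, Or.inr h]
    have hēX : P X = ēJ J X ∨ P' X = ēJ J X := by rcases hXp with ⟨_, h⟩ | ⟨h, _⟩; exacts [Or.inr h, Or.inl h]
    have heY : P Y = eJ J Y ∨ P' Y = eJ J Y := by rcases hYp with ⟨h, _⟩ | ⟨_, h⟩; exacts [Or.inl h, Or.inr h]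
    have hēY : P Y = ēJ J Y ∨ P' Y = ēJ J Y := by rcases hYp with ⟨_, h⟩ | ⟨h, _⟩; exacts [Or.inr h, Or.inl h]
    have heēX : eJ J X ≠ ēJ J X := by
      rcases hXp with ⟨h1, h2⟩ | ⟨h1, h2⟩
      · rw [← h1, ← h2]; exact hPP' X
      · rw [← h1, ← h2]; exact (hPP' X).symm
    -- ports of `J` versus far ports
    have hinJ : ∀ q, (P J = q ∨ P' J = q) → q ≠ ēJ J X ∧ q ≠ ēJ J Y := by
      intro q hq
      constructor
      · rintro rfl; exact hJēX hq
      · rintro rfl; exact hJēY hq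
    have hx12 : eJ J X ≠ ēJ J Y := (hinJ _ heX').2
    have hx23 : ēJ J Y ≠ sJ J X := fun h => (hinJ _ hJsX).2 h.symm
    have hy12 : ēJ J X ≠ eJ J Y := fun h => (hinJ _ heY').1 h.symm
    have hy13 : ēJ J X ≠ sJ J Y := fun h => (hinJ _ hJsY).1 h.symm
    have hXJ : X ≠ J := fun h => hXF (h ▸ hJF)
    have hYJ : Y ≠ J := fun h => hYF (h ▸ hJF)
    obtain ⟨-, hx1, -, -, -⟩ := designation_valid P P' r O hXY hXJ hYJ heX hēY hJsX hx12 hseX.symm hx23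
      (hport_r _ _ hXr heX) (hport_r _ _ hYr hēY) (hport_r _ _ hJr hJsX)
    obtain ⟨-, -, hy2, -, -⟩ := designation_valid P P' r O hXY hXJ hYJ hēX heY hJsY hy12 hy13 hseY.symm
      (hport_r _ _ hXr hēX) (hport_r _ _ hYr heY) (hport_r _ _ hJr hJsY)
    have hQ : ∀ (δ : ι → Bool) (K : ι), K ∈ ({X, Y, J} : Finset ι) → K ∉ F → (P J = (if δ K then P K else P' K) ∨
        P' J = (if δ K then P K else P' K)) →
        ¬ ∀ K ∈ ({X, Y, J} : Finset ι), K ∉ F → ∀ I ∈ ({X, Y, J} : Finset ι), I ∈ F →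
          (if δ K then P K else P' K) ≠ P I ∧ (if δ K then P K else P' K) ≠ P' I := by
      intro δ K hK hKF hKJ hall
      have h := hall K hK hKF J (by simp) hJF
      rcases hKJ with h' | h'; exacts [h.1 h'.symm, h.2 h'.symm]
    have hw2 := two_words_le_cap_filter P P' r O hO0 hXY hXJ hYJ heX hēY hJsX hx12 hseX.symm hx23
      (hport_r _ _ hXr heX) (hport_r _ _ hYr hēY) (hport_r _ _ hJr hJsX)
      hēX heY hJsY hy12 hy13 hseY.symm (hport_r _ _ hXr hēX) (hport_r _ _ hYr heY) (hport_r _ _ hJr hJsY) (Or.inl heēX)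
      (fun δ => ¬ ∀ K ∈ ({X, Y, J} : Finset ι), K ∉ F → ∀ I ∈ ({X, Y, J} : Finset ι), I ∈ F →
        (if δ K then P K else P' K) ≠ P I ∧ (if δ K then P K else P' K) ≠ P' I)
      (hQ _ X (by simp) hXF (by rw [hx1]; exact heX')) (hQ _ Y (by simp) hYF (by rw [hy2]; exact heY'))
    have hwXY : w J X Y + w J Y X = O X (eJ J X) * O Y (ēJ J Y) * O J (sJ J X) + O X (ēJ J X) * O Y (eJ J Y) * O J (sJ J Y) := by
      simp only [hw]; ring
    rw [hwXY]
    exact hw2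
  -- step 3: injectivity of the pair ↦ class-set map and the index set
  set E' : Finset (ι × ι) := (Js ×ˢ (univ : Finset ι)).filter (fun p => p.2 ∈ 𝒳 p.1) with hE'
  set Tr : Finset ((ι × ι) × ι) := (E' ×ˢ (univ : Finset ι)).filter
    (fun q => q.2 ∈ (𝒳 q.1.1).filter (fun Y => q.1.2 < Y ∧ ¬ (q.1.2 ≠ Y ∧ ēJ q.1.1 q.1.2 = ēJ q.1.1 Y))) with hTr
  have hsum1 : ∀ g : ι → ι → ℝ, ∑ J ∈ Js, ∑ X ∈ 𝒳 J, g J X = ∑ p ∈ E', g p.1 p.2 := fun g =>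
    (sum_finset_product (f := fun p : ι × ι => g p.1 p.2) E' Js 𝒳 (fun p => by
      simp only [hE', mem_filter, mem_product, mem_univ, and_true])).symm
  have hsum2 : ∀ g : (ι × ι) → ι → ℝ, ∑ p ∈ E', ∑ Y ∈ (𝒳 p.1).filter (fun Y => p.2 < Y ∧ ¬ (p.2 ≠ Y ∧ ēJ p.1 p.2 = ēJ p.1 Y)), g p Y =
      ∑ q ∈ Tr, g q.1 q.2 := fun g =>
    (sum_finset_product (f := fun q : (ι × ι) × ι => g q.1 q.2) Tr E'
      (fun p => (𝒳 p.1).filter (fun Y => p.2 < Y ∧ ¬ (p.2 ≠ Y ∧ ēJ p.1 p.2 = ēJ p.1 Y))) (fun q => by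
      simp only [hTr, mem_filter, mem_product, mem_univ, and_true])).symm
  have hTrfacts : ∀ q ∈ Tr, q.1.1 ∈ Js ∧ q.1.2 ∈ 𝒳 q.1.1 ∧
      q.2 ∈ (𝒳 q.1.1).filter (fun Y => q.1.2 < Y ∧ ¬ (q.1.2 ≠ Y ∧ ēJ q.1.1 q.1.2 = ēJ q.1.1 Y)) := by
    intro q hq
    obtain ⟨hq1, hq2⟩ := mem_filter.1 hq
    obtain ⟨hp, -⟩ := mem_product.1 hq1
    obtain ⟨hp1, hp2⟩ := mem_filter.1 hp
    exact ⟨(mem_product.1 hp1).1, hp2, hq2⟩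
  have hinjT : Set.InjOn (fun q : (ι × ι) × ι => ({q.1.2, q.2, q.1.1} : Finset ι)) ↑Tr := by
    intro q hq q' hq' h
    dsimp only at h
    obtain ⟨-, hX, hY⟩ := hTrfacts q (mem_coe.1 hq)
    obtain ⟨-, hX', hY'⟩ := hTrfacts q' (mem_coe.1 hq')
    obtain ⟨hY, hlt, -⟩ := mem_filter.1 hY
    obtain ⟨hY', hlt', -⟩ := mem_filter.1 hY'
    obtain ⟨hXF, -, hJF, -⟩ := hXfacts _ _ hX
    obtain ⟨hYF, -⟩ := hXfacts _ _ hY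
    obtain ⟨hXF', -, hJF', -⟩ := hXfacts _ _ hX'
    obtain ⟨hYF', -⟩ := hXfacts _ _ hY'
    have h1 : q.1.2 ∈ ({q'.1.2, q'.2, q'.1.1} : Finset ι) := by rw [← h]; exact mem_insert_self _ _
    have h2 : q.2 ∈ ({q'.1.2, q'.2, q'.1.1} : Finset ι) := by rw [← h]; exact mem_insert_of_mem (mem_insert_self _ _)
    have h3 : q.1.1 ∈ ({q'.1.2, q'.2, q'.1.1} : Finset ι) := by rw [← h]; simp
    have h1' : q'.1.2 ∈ ({q.1.2, q.2, q.1.1} : Finset ι) := by rw [h]; exact mem_insert_self _ _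
    simp only [mem_insert, mem_singleton] at h1 h2 h3 h1'
    have hJ : q.1.1 = q'.1.1 := by
      rcases h3 with h3 | h3 | h3
      · exact absurd (h3 ▸ hJF) hXF'
      · exact absurd (h3 ▸ hJF) hYF'
      · exact h3
    have hXY : q.1.2 = q'.1.2 ∧ q.2 = q'.2 := by
      rcases h1 with h1 | h1 | h1
      · rcases h2 with h2 | h2 | h2
        · exact absurd (h1.trans h2.symm) (ne_of_lt hlt)
        · exact ⟨h1, h2⟩
        · exact absurd (h2 ▸ hJF') hYF
      · rcases h1' with h1' | h1' | h1'
        · exact absurd (h1'.trans h1) (ne_of_lt hlt')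
        · rw [h1] at hlt; rw [h1'] at hlt'; exact absurd (lt_trans hlt hlt') (lt_irrefl _)
        · exact absurd (h1' ▸ hJF) hXF'
      · exact absurd (h1 ▸ hJF') hXF
    exact Prod.ext (Prod.ext hJ hXY.1) hXY.2
  -- assemble
  have hmain : ∑ J ∈ Js, ∑ X ∈ 𝒳 J, ∑ Y ∈ (𝒳 J).filter (fun Y => Y ≠ X ∧ ¬ (X ≠ Y ∧ ēJ J X = ēJ J Y)), w J X Y ≤
      ∑ T ∈ Tr.image (fun q : (ι × ι) × ι => ({q.1.2, q.2, q.1.1} : Finset ι)), cr T := by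
    rw [sum_congr rfl hsym, sum_image hinjT]
    calc ∑ J ∈ Js, ∑ X ∈ 𝒳 J, ∑ Y ∈ (𝒳 J).filter (fun Y => X < Y ∧ ¬ (X ≠ Y ∧ ēJ J X = ēJ J Y)), (w J X Y + w J Y X)
        ≤ ∑ J ∈ Js, ∑ X ∈ 𝒳 J, ∑ Y ∈ (𝒳 J).filter (fun Y => X < Y ∧ ¬ (X ≠ Y ∧ ēJ J X = ēJ J Y)),
            cr ({X, Y, J} : Finset ι) :=
          sum_le_sum fun J hJ => sum_le_sum fun X hX => sum_le_sum fun Y hY => hpair J hJ X hX Y hY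
      _ = ∑ q ∈ Tr, cr ({q.1.2, q.2, q.1.1} : Finset ι) := by
          rw [hsum1 (fun J X => ∑ Y ∈ (𝒳 J).filter (fun Y => X < Y ∧ ¬ (X ≠ Y ∧ ēJ J X = ēJ J Y)), cr ({X, Y, J} : Finset ι)),
            hsum2 (fun p Y => cr ({p.2, Y, p.1} : Finset ι))]
  refine le_trans (by simpa only [hw] using hmain) (sum_le_sum_of_subset_of_nonneg (fun T hT => ?_) fun T _ _ => hcr0 T)
  obtain ⟨q, hq, rfl⟩ := mem_image.1 hT
  obtain ⟨-, hX, hY⟩ := hTrfacts q hq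
  obtain ⟨hY, hlt, hnm⟩ := mem_filter.1 hY
  obtain ⟨u, hu, huJ, huX⟩ := hwit _ _ hX
  obtain ⟨v, hv, hvJ, hvY⟩ := hwit _ _ hY
  refine mem_image.2 ⟨(u, v), mem_filter.2 ⟨mem_product.2 ⟨hu, hv⟩, huJ.trans hvJ.symm, ?_, ?_⟩, ?_⟩
  · rw [huX, hvY]; exact hlt
  · rw [huJ, huX, hvY]; exact hnm
  · rw [huX, hvY, huJ]

end StarSet

end Summit.CriticalPhenomena.PercolationContinuityZ3.Theorems
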